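import Mathlib
import Literature.RepresentationTheory.FiniteGroups.InducedClassFunction
import Summits.MatrixMultiplication.MatrixMultiplication.Theorems.SubgroupIdentityDesigns.Negative.ParabolicSubgroup
import Summits.MatrixMultiplication.MatrixMultiplication.Theorems.SubgroupIdentityDesigns.Negative.ParabolicRestriction

/-!
# The linked pair group `C_i ≤ GL_c(F) × GL_j(F)` and its character sum

Support file toward the maximal-parabolic Mackey formula `SteinbergTower.MackeyFormula`
(crux `SubgroupIdentityDesigns`, negative side; VALUE = reusable finite-group bookkeeping,
NOT summit progress).

`C_i = {(A, B) ∈ P^c_i × P^j_i : ul_i A = ul_i B}` (`linkSub`) is the image of the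
intersection group `P_c ∩ w(π_i) P_j w(π_i)⁻¹` under `y ↦ (ul_c y, ul_j(w⁻¹ y w))`
(`ParabolicMackey`).  Here we evaluate, for functions `σ` on `GL_c(F)`, `τ` on `GL_j(F)`,

  `∑_{(A,B) ∈ C_i} σ(A) τ(B⁻¹) = |Q^c_i| |Q^j_i| |GL_i| · ⟨r_i σ, r_i τ⟩_{GL_i}`   (`sum_linkSub`)

(`r_i = hcRes`, Harish-Chandra restriction; `Q = fixer`), and `|C_i| = |Q^c_i| |Q^j_i| |GL_i|`
(`card_linkSub`).  [folklore]
-/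

set_option linter.dupNamespace false
set_option maxHeartbeats 800000

noncomputable section

open scoped BigOperators Classical
open Literature.RepresentationTheory.FiniteGroups

namespace Summit.MatrixMultiplication.MatrixMultiplication.Theorems.SubgroupIdentityDesigns.Negative

namespace ParabolicLink

open ParabolicSubgroup ParabolicRestriction

variable {F : Type} [Field F] [Fintype F] [DecidableEq F] {a c j i : ℕ}

/-! ## Fibre sums of `ul` -/

/-- `|ker ul| = |Q^a_c|`. -/
theorem card_ker_ul (hc : c ≤ a) : Nat.card (ul (F := F) hc).ker = Nat.card (fixer F a c) := by
  rw [ker_ul_eq]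
  exact Nat.card_congr
    (Subgroup.subgroupOfEquivOfLe (fixer_le_parab (F := F) (a := a) (c := c))).toEquiv

/-- **Fibre sum of `ul`**: `∑_{g ∈ P^a_c, ul g = x} Φ(g) = |Q^a_c| · (r Φ)(x)`. -/
theorem sum_ite_ul_eq (hc : c ≤ a) (Φ : GL (Fin a) F → ℂ) (x : GL (Fin c) F) :
    ∑ g : parab F a c, (if ul hc g = x then Φ g else 0) =
      (Nat.card (fixer F a c) : ℂ) * hcRes hc Φ x := by
  have h0 : (Nat.card (fixer F a c) : ℂ) ≠ 0 := by
    rw [Nat.card_eq_fintype_card]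
    exact Nat.cast_ne_zero.mpr Fintype.card_ne_zero
  rw [hcRes, ← mul_assoc, mul_inv_cancel₀ h0, one_mul]

/-- The number of `g ∈ P^a_c` with `ul g = x` is `|Q^a_c|`. -/
theorem sum_ite_ul_one (hc : c ≤ a) (x : GL (Fin c) F) :
    ∑ g : parab F a c, (if ul hc g = x then (1 : ℂ) else 0) = Nat.card (fixer F a c) := by
  have h := sum_comp_eq_card_ker_mul (ul (F := F) hc) (ul_surjective hc)
    (fun y => if y = x then (1 : ℂ) else 0)
  simp only [Finset.sum_ite_eq', Finset.mem_univ, if_true, mul_one] at h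
  rw [h, card_ker_ul]

/-- `r(1) = 1`: the Harish-Chandra restriction of the constant `1`. -/
theorem hcRes_one (hc : c ≤ a) (x : GL (Fin c) F) : hcRes hc (fun _ => (1 : ℂ)) x = 1 := by
  have h0 : (Nat.card (fixer F a c) : ℂ) ≠ 0 := by
    rw [Nat.card_eq_fintype_card]
    exact Nat.cast_ne_zero.mpr Fintype.card_ne_zero
  have h := sum_ite_ul_eq hc (fun _ => (1 : ℂ)) x
  rw [sum_ite_ul_one] at h
  have h2 : (Nat.card (fixer F a c) : ℂ) * hcRes hc (fun _ => (1 : ℂ)) x =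
      (Nat.card (fixer F a c) : ℂ) * 1 := by rw [mul_one]; exact h.symm
  exact mul_left_cancel₀ h0 h2

/-! ## The linked pair group -/

/-- **The linked pair group** `C_i = {(A, B) ∈ P^c_i × P^j_i : ul_i A = ul_i B}`. -/
def linkSub (F : Type) [Field F] [Fintype F] [DecidableEq F] (hic : i ≤ c) (hij : i ≤ j) :
    Subgroup (GL (Fin c) F × GL (Fin j) F) :=
  { carrier := {z | z.1 ∈ parab F c i ∧ z.2 ∈ parab F j i ∧
      ulMat hic (z.1 : Matrix (Fin c) (Fin c) F) = ulMat hij (z.2 : Matrix (Fin j) (Fin j) F)}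
    one_mem' := ⟨(parab F c i).one_mem, (parab F j i).one_mem, by
      simp only [Prod.fst_one, Prod.snd_one, Units.val_one, ulMat_one]⟩
    mul_mem' := by
      rintro z w ⟨hz1, hz2, hz3⟩ ⟨hw1, hw2, hw3⟩
      refine ⟨(parab F c i).mul_mem hz1 hw1, (parab F j i).mul_mem hz2 hw2, ?_⟩
      simp only [Prod.fst_mul, Prod.snd_mul, Units.val_mul]
      rw [ulMat_mul hic _ _ (mem_parab.mp hw1), ulMat_mul hij _ _ (mem_parab.mp hw2), hz3, hw3]
    inv_mem' := by
      intro z hz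
      have h1 : (1 : GL (Fin c) F × GL (Fin j) F) ∈ {z : GL (Fin c) F × GL (Fin j) F |
          z.1 ∈ parab F c i ∧ z.2 ∈ parab F j i ∧
          ulMat hic (z.1 : Matrix (Fin c) (Fin c) F) = ulMat hij (z.2 : Matrix (Fin j) (Fin j) F)} :=
        ⟨(parab F c i).one_mem, (parab F j i).one_mem, by
          simp only [Prod.fst_one, Prod.snd_one, Units.val_one, ulMat_one]⟩
      refine inv_mem_of_mul_closed h1 ?_ hz
      rintro z w ⟨hz1, hz2, hz3⟩ ⟨hw1, hw2, hw3⟩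
      refine ⟨(parab F c i).mul_mem hz1 hw1, (parab F j i).mul_mem hz2 hw2, ?_⟩
      simp only [Prod.fst_mul, Prod.snd_mul, Units.val_mul]
      rw [ulMat_mul hic _ _ (mem_parab.mp hw1), ulMat_mul hij _ _ (mem_parab.mp hw2), hz3, hw3] }

/-- Membership in `C_i`. -/
theorem mem_linkSub (hic : i ≤ c) (hij : i ≤ j) {z : GL (Fin c) F × GL (Fin j) F} :
    z ∈ linkSub F hic hij ↔ z.1 ∈ parab F c i ∧ z.2 ∈ parab F j i ∧
      ulMat hic (z.1 : Matrix (Fin c) (Fin c) F) = ulMat hij (z.2 : Matrix (Fin j) (Fin j) F) :=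
  Iff.rfl

/-- The linking condition in terms of `ul`: for `A ∈ P^c_i`, `B ∈ P^j_i`,
`ulMat A = ulMat B ↔ ul A = ul B`. -/
theorem ulMat_eq_iff (hic : i ≤ c) (hij : i ≤ j) (A : parab F c i) (B : parab F j i) :
    ulMat hic ((A : GL (Fin c) F) : Matrix (Fin c) (Fin c) F) =
        ulMat hij ((B : GL (Fin j) F) : Matrix (Fin j) (Fin j) F) ↔ ul hic A = ul hij B := by
  rw [Units.ext_iff]
  rfl

/-! ## The character sum over `C_i` -/

/-- Inner fibre sum: `∑_{B ∈ P^j_i, ul B = u} τ(B⁻¹) = |Q^j_i| (r τ)(u⁻¹)`. -/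
theorem sum_ite_ul_inv (hij : i ≤ j) (τ : GL (Fin j) F → ℂ) (u : GL (Fin i) F) :
    ∑ B : parab F j i, (if ul hij B = u then τ ((B : GL (Fin j) F))⁻¹ else 0) =
      (Nat.card (fixer F j i) : ℂ) * hcRes hij τ u⁻¹ := by
  rw [← sum_ite_ul_eq hij τ u⁻¹]
  refine Fintype.sum_equiv (Equiv.inv (parab F j i)) _ _ fun B => ?_
  simp only [Equiv.inv_apply, map_inv, inv_inj, Subgroup.coe_inv]

/-- **The character sum over `C_i`**:
`∑_{(A,B) ∈ C_i} σ(A) τ(B⁻¹) = |Q^c_i| |Q^j_i| |GL_i| ⟨r_i σ, r_i τ⟩`. -/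
theorem sum_linkSub (hic : i ≤ c) (hij : i ≤ j) (σ : GL (Fin c) F → ℂ) (τ : GL (Fin j) F → ℂ) :
    ∑ z : linkSub F hic hij,
        σ ((z : GL (Fin c) F × GL (Fin j) F)).1 * τ (((z : GL (Fin c) F × GL (Fin j) F)).2)⁻¹ =
      ((Nat.card (fixer F c i) : ℂ) * Nat.card (fixer F j i) * Nat.card (GL (Fin i) F)) *
        classInner (hcRes hic σ) (hcRes hij τ) := by
  -- Step 1: as a sum over `GL_c × GL_j` of a function supported on `C_i`
  set K : GL (Fin c) F × GL (Fin j) F → ℂ := fun w =>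
    if w ∈ linkSub F hic hij then σ w.1 * τ (w.2)⁻¹ else 0 with hK
  have h1a : ∑ z : linkSub F hic hij,
      σ ((z : GL (Fin c) F × GL (Fin j) F)).1 * τ (((z : GL (Fin c) F × GL (Fin j) F)).2)⁻¹ =
      ∑ z : linkSub F hic hij, K z := by
    refine Finset.sum_congr rfl fun z _ => ?_
    rw [hK]
    simp only [if_pos z.2]
  have h1 : ∑ z : linkSub F hic hij, K z = ∑ w : GL (Fin c) F × GL (Fin j) F, K w := by
    rw [← Finset.sum_subtype (p := fun w => w ∈ linkSub F hic hij)
      (Finset.univ.filter (· ∈ linkSub F hic hij)) (by simp) K, Finset.sum_filter]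
    refine Finset.sum_congr rfl fun w _ => ?_
    by_cases hw : w ∈ linkSub F hic hij
    · rw [if_pos hw]
    · rw [if_neg hw, hK]
      simp only [if_neg hw]
  -- Step 2: restrict both coordinates to the parabolics
  set L : parab F c i → parab F j i → ℂ := fun A B =>
    if ul hic A = ul hij B then σ A * τ ((B : GL (Fin j) F))⁻¹ else 0 with hL
  have hKL : ∀ (A : parab F c i) (B : parab F j i),
      K ((A : GL (Fin c) F), (B : GL (Fin j) F)) = L A B := by
    intro A B
    rw [hK, hL]
    simp only [mem_linkSub, ulMat_eq_iff]
    by_cases h : ul hic A = ul hij B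
    · rw [if_pos ⟨A.2, B.2, h⟩, if_pos h]
    · rw [if_neg (fun h' => h h'.2.2), if_neg h]
  have h2 : ∑ w : GL (Fin c) F × GL (Fin j) F, K w =
      ∑ A : parab F c i, ∑ B : parab F j i, L A B := by
    rw [Fintype.sum_prod_type]
    -- outer sum: terms with `A ∉ P^c_i` vanish
    have hout : ∀ A : GL (Fin c) F, A ∉ parab F c i → ∑ B : GL (Fin j) F, K (A, B) = 0 := by
      intro A hA
      refine Finset.sum_eq_zero fun B _ => ?_
      rw [hK]
      simp only
      rw [if_neg (fun h => hA h.1)]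
    rw [← Finset.sum_subset (Finset.subset_univ (Finset.univ.filter (· ∈ parab F c i)))
      (fun A _ hA => hout A (by simpa using hA)),
      Finset.sum_subtype (p := fun A => A ∈ parab F c i)
        (Finset.univ.filter (· ∈ parab F c i)) (by simp)]
    refine Finset.sum_congr rfl fun A _ => ?_
    have hin : ∀ B : GL (Fin j) F, B ∉ parab F j i → K ((A : GL (Fin c) F), B) = 0 := by
      intro B hB
      rw [hK]
      simp only
      rw [if_neg (fun h => hB h.2.1)]
    rw [← Finset.sum_subset (Finset.subset_univ (Finset.univ.filter (· ∈ parab F j i)))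
      (fun B _ hB => hin B (by simpa using hB)),
      Finset.sum_subtype (p := fun B => B ∈ parab F j i)
        (Finset.univ.filter (· ∈ parab F j i)) (by simp)]
    exact Finset.sum_congr rfl fun B _ => hKL A B
  -- Step 3: inner sum over `B`
  have h3 : ∀ A : parab F c i, ∑ B : parab F j i, L A B =
      σ A * ((Nat.card (fixer F j i) : ℂ) * hcRes hij τ (ul hic A)⁻¹) := by
    intro A
    rw [← sum_ite_ul_inv hij τ (ul hic A), Finset.mul_sum]
    refine Finset.sum_congr rfl fun B _ => ?_
    rw [hL]
    simp only
    by_cases h : ul hic A = ul hij B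
    · rw [if_pos h, if_pos h.symm]
    · rw [if_neg h, if_neg (fun h' => h h'.symm), mul_zero]
  -- Step 4: outer sum over `A`, fibrewise along `ul`
  have h4 : ∑ A : parab F c i, σ A * ((Nat.card (fixer F j i) : ℂ) * hcRes hij τ (ul hic A)⁻¹) =
      (Nat.card (fixer F j i) : ℂ) * ((Nat.card (fixer F c i) : ℂ) *
        ∑ x : GL (Fin i) F, hcRes hic σ x * hcRes hij τ x⁻¹) := by
    have step : ∀ A : parab F c i,
        σ A * ((Nat.card (fixer F j i) : ℂ) * hcRes hij τ (ul hic A)⁻¹) =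
          ∑ x : GL (Fin i) F, (if ul hic A = x then σ A else 0) *
            ((Nat.card (fixer F j i) : ℂ) * hcRes hij τ x⁻¹) := by
      intro A
      rw [Finset.sum_eq_single (ul hic A)]
      · rw [if_pos rfl]
      · intro x _ hx
        rw [if_neg (Ne.symm hx), zero_mul]
      · intro h
        exact absurd (Finset.mem_univ _) h
    rw [Finset.sum_congr rfl fun A _ => step A, Finset.sum_comm, Finset.mul_sum, Finset.mul_sum]
    refine Finset.sum_congr rfl fun x _ => ?_
    rw [← Finset.sum_mul, sum_ite_ul_eq hic σ x]
    ring
  have hG : (Nat.card (GL (Fin i) F) : ℂ) ≠ 0 := by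
    rw [Nat.card_eq_fintype_card]
    exact Nat.cast_ne_zero.mpr Fintype.card_ne_zero
  rw [h1a, h1, h2, Finset.sum_congr rfl fun A _ => h3 A, h4, classInner_apply,
    ← Nat.card_eq_fintype_card, mul_assoc ((Nat.card (fixer F c i) : ℂ) * Nat.card (fixer F j i))
      (Nat.card (GL (Fin i) F) : ℂ), mul_inv_cancel_left₀ hG]
  ring

/-- **`|C_i| = |Q^c_i| |Q^j_i| |GL_i|`.** -/
theorem card_linkSub (hic : i ≤ c) (hij : i ≤ j) :
    (Nat.card (linkSub F hic hij) : ℂ) =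
      (Nat.card (fixer F c i) : ℂ) * Nat.card (fixer F j i) * Nat.card (GL (Fin i) F) := by
  have h := sum_linkSub hic hij (fun _ : GL (Fin c) F => (1 : ℂ)) (fun _ : GL (Fin j) F => (1 : ℂ))
  simp only [mul_one, Finset.sum_const, Finset.card_univ, nsmul_eq_mul, ← Nat.card_eq_fintype_card]
    at h
  rw [h]
  have h1 : classInner (hcRes hic fun _ : GL (Fin c) F => (1 : ℂ))
      (hcRes hij fun _ : GL (Fin j) F => (1 : ℂ)) = 1 := by
    rw [classInner_apply]
    simp only [hcRes_one, mul_one, Finset.sum_const, Finset.card_univ, nsmul_eq_mul]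
    exact inv_mul_cancel₀ (Nat.cast_ne_zero.mpr Fintype.card_ne_zero)
  rw [h1, mul_one]

end ParabolicLink

end Summit.MatrixMultiplication.MatrixMultiplication.Theorems.SubgroupIdentityDesigns.Negative

end
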